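import Literature.Geometry.Kaehler.ComplexTorusEffectiveClassesSelfProduct
import Literature.Geometry.Kaehler.ComplexTorusDivisorClassesKunneth
import HarnessLib

/-!
# Bauer 1998, Thm. 4.2 for two simple factors: `N(X₁ × X₂)` is finitely generated iff `X₁`, `X₂` are
# non-isogenous with `NS(X₁) ≅ NS(X₂) ≅ ℤ`; finite generation of `N` descends to factors and, for
# `Hom(X₂, X₁) = 0`, ascends from them

Layer `Literature/Geometry/Kaehler`, namespace `Literature.Geometry.Kaehler.ComplexTorus`; lane
`lit-hodgefound`, seat p07 (generation 44), programme «THE NEF CONE OF AN ABELIAN VARIETY», file 53 of the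
seat lineage; sequel of `ComplexTorusNefConePolyhedralSimple` (file 50: Prop. 2.2, the simple case),
`ComplexTorusEffectiveClassesIsogeny` (file 51: Lemma 4.1), `ComplexTorusEffectiveClassesSelfProduct` (file 52:
Prop. 3.1, `N(X × X)` is never finitely generated) and of `ComplexTorusDivisorClassesKunneth` (Milne's
`NS(X₁ × X₂) = NS(X₁) ⊕ NS(X₂) ⊕ DC(X₁, X₂)`: restriction to the factors `IsNSForm.comp_inl/inr`, the
decomposition `η = p₁^*(ι₁^*η) + p₂^*(ι₂^*η)` when the divisorial correspondences vanish, and `DC = 0` from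
`Hom_ℚ(X₂, X₁) = 0`, which holds for non-isogenous simple tori, `IsSimple.homRat_eq_bot`). Theorems only (no
definition, no named fact, no instance, no notation; net debt `0`).

THE SOURCE (Th. Bauer, *On the cone of curves of an abelian variety*, Amer. J. Math. 120 (1998), §4; held
arXiv alg-geom/9712019, p. 5), VERBATIM. **Theorem 4.2.** "The semi-group `N(X)` is finitely generated if and
only if `NS(Xᵢ) ≅ ℤ` and `nᵢ = 1` for `1 ≤ i ≤ r`" (for `X ~ X₁^{n₁} × ⋯ × X_r^{n_r}`, `Xᵢ` simple and
mutually non-isogenous). Proof, "if": "By Lemma 4.1 we may assume that `X` is the product `X₁ × ⋯ × X_r`.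
Fix for `1 ≤ i ≤ r` an ample generator `Nᵢ` of `Pic(Xᵢ)` […] Due to the fact that the `Xᵢ` are
non-isogenous, we have `NS_ℚ(∏ Xᵢ) ≅ End^s_ℚ(∏ Xᵢ) ≅ ⊕ End^s_ℚ(Xᵢ) ≅ ⊕ NS_ℚ(Xᵢ)`. Therefore
`N(X) = ⊕ ℤ⁺·[Nᵢ]` is finitely generated." Proof, "only if": "Note that if `V₁` and `V₂` are varieties such
that `N(V₁ × V₂)` is finitely generated, then `N(V₁)` and `N(V₂)` are finitely generated as well. So in
particular Proposition 2.2 applies to the factors `Xᵢ` and shows that we have `NS(Xᵢ) ≅ ℤ` for all `i`.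
Further, if we had `nᵢ > 1` for some `i` […] then `N(Xᵢ × Xᵢ)` would be finitely generated, which however is
impossible according to Proposition 3.1."

THIS FILE (torus level, `X₁ × X₂ = (E₁ × E₂)/(Λ₁ ⊕ Λ₂)` = `prodPeriod Φ₁ Φ₂`; `N(X) = {η ∈ NS(X) | H_η ≥ 0}`,
the semi-positive = effective = nef classes as in files 50–52):
* §1 restriction and pull-back between `N(X₁ × X₂)` and `N(X₁)`, `N(X₂)`: `p₁^*`, `p₂^*` map `N(Xᵢ)` into
  `N(X₁ × X₂)`, `ι₁^*`, `ι₂^*` map back, `ι₁^* p₁^* = id`.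
* §2 **"`N(V₁ × V₂)` finitely generated ⟹ `N(V₁)` and `N(V₂)` finitely generated"**
  (`exists_finset_addSubmonoidClosure_eq_left/right_of_prod`: the restriction `ι₁^*` is a surjective
  monoid homomorphism `N(X₁ × X₂) → N(X₁)` with section `p₁^*`) — for ALL complex tori.
* §3 **"`N(X₁ × X₂) = N(X₁) ⊕ N(X₂)`" when `DC(X₁, X₂) ⊗ ℚ = 0`** (`setOf_semipos_prod_eq_of_forall_apply_inl_inr_eq_zero`:
  every semi-positive class of the product is `p₁^*a + p₂^*b` with `a`, `b` semi-positive on the factors),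
  hence `exists_finset_addSubmonoidClosure_eq_prod_of_forall_apply_inl_inr_eq_zero` (finite generation
  ascends) and, for abelian varieties with `Hom_ℚ(X₂, X₁) = 0`, `IsAbelianVariety.…_of_homRat_eq_bot`.
* §4 **THM. 4.2 FOR TWO SIMPLE FACTORS**:
  `IsSimple.exists_finset_addSubmonoidClosure_eq_prod_iff` — for simple abelian varieties `X₁, X₂ ≠ 0`,
  `N(X₁ × X₂)` is finitely generated iff `X₁ ≁ X₂`, `rk NS(X₁) = 1` and `rk NS(X₂) = 1` ("only if": §2 +
  Prop. 2.2 of file 50, and `X₁ ~ X₂ ⟹ X₁ × X₂ ~ X₂ × X₂`, impossible by Prop. 3.1 of file 52 with Lemma 4.1;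
  "if": `N(Xᵢ) = ℤ⁺·[Mᵢ]` from file 50 and §3 with `DC = 0` for non-isogenous simple factors) — and its
  transport along isogenies `IsIsogenous.exists_finset_addSubmonoidClosure_eq_iff_of_prod` (THE THEOREM,
  (ic) ⟺ (ii), for every complex torus isogenous to a product of two simple abelian varieties).

## References

* [Bauer1998ConeOfCurves] Th. Bauer, *On the cone of curves of an abelian variety*, Amer. J. Math. 120 (1998)
  997–1006, §4 Thm. 4.2 and its proof, Lemma 4.1, §3 Prop. 3.1, §2 Prop. 2.2 (held: arXiv alg-geom/9712019,
  pp. 3–5).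
* [Milne1999LefschetzClasses] J. S. Milne, *Lefschetz classes on abelian varieties*, Duke Math. J. 96 (1999),
  §4 Prop. 4.1, Cor. 4.2 (`NS(X × Y) ≅ NS(X) ⊕ NS(Y) ⊕ DC(X, Y)`; `Hom(A, B) = 0 ⟹ DC(A, B) = 0`).
* [Lange2023AbelianVarietiesComplex] H. Lange, *Abelian Varieties over the Complex Numbers*, Springer 2023,
  §2.4.4 Cor. 2.4.26 (`Hom = 0` between non-isogenous simple tori), §5.3 (products).
-/

noncomputable section

open scoped Manifold ComplexOrder NNReal
open Complex Set Function Module Filter Topology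

universe u

namespace Literature.Geometry.Kaehler

namespace ComplexTorus

/-! ### §1 `p₁^*`, `p₂^*`, `ι₁^*`, `ι₂^*` between `N(X₁ × X₂)` and `N(X₁)`, `N(X₂)` -/

section Restrict

variable {ι₁ ι₂ : Type*} [Fintype ι₁] [Fintype ι₂] {E₁ E₂ : Type*} [NormedAddCommGroup E₁] [NormedSpace ℂ E₁]
  [NormedAddCommGroup E₂] [NormedSpace ℂ E₂] (Φ₁ : (ι₁ → ℝ) ≃L[ℝ] E₁) (Φ₂ : (ι₂ → ℝ) ≃L[ℝ] E₂)

omit [Fintype ι₁] [Fintype ι₂] in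
/-- `ι₁^* p₁^* = id`: `(η ∘ p₁) ∘ ι₁ = η`. [folklore] -/
private theorem compFst_compInl (η : E₁ [⋀^Fin 2]→L[ℝ] ℝ) :
    (η.compContinuousLinearMap (ContinuousLinearMap.fst ℝ E₁ E₂)).compContinuousLinearMap
        (ContinuousLinearMap.inl ℝ E₁ E₂) = η := by
  ext v
  rfl

omit [Fintype ι₁] [Fintype ι₂] in
/-- `ι₂^* p₂^* = id`: `(η ∘ p₂) ∘ ι₂ = η`. [folklore] -/
private theorem compSnd_compInr (η : E₂ [⋀^Fin 2]→L[ℝ] ℝ) :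
    (η.compContinuousLinearMap (ContinuousLinearMap.snd ℝ E₁ E₂)).compContinuousLinearMap
        (ContinuousLinearMap.inr ℝ E₁ E₂) = η := by
  ext v
  rfl

omit [Fintype ι₁] [Fintype ι₂] in
/-- `H_{p₁^*a}(x, y) = H_a(x)`. [folklore] -/
private theorem compFst_apply_I_smul_self (a : E₁ [⋀^Fin 2]→L[ℝ] ℝ) (v : E₁ × E₂) :
    (a.compContinuousLinearMap (ContinuousLinearMap.fst ℝ E₁ E₂)) ![I • v, v] = a ![I • v.1, v.1] := by
  rw [ContinuousAlternatingMap.compContinuousLinearMap_apply]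
  congr 1
  funext i
  fin_cases i <;> rfl

omit [Fintype ι₁] [Fintype ι₂] in
/-- `H_{p₂^*b}(x, y) = H_b(y)`. [folklore] -/
private theorem compSnd_apply_I_smul_self (b : E₂ [⋀^Fin 2]→L[ℝ] ℝ) (v : E₁ × E₂) :
    (b.compContinuousLinearMap (ContinuousLinearMap.snd ℝ E₁ E₂)) ![I • v, v] = b ![I • v.2, v.2] := by
  rw [ContinuousAlternatingMap.compContinuousLinearMap_apply]
  congr 1
  funext i
  fin_cases i <;> rfl

omit [Fintype ι₁] [Fintype ι₂] in
/-- `H_{ι₁^*θ}(u) = H_θ(u, 0)`. [folklore] -/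
private theorem compInl_apply_I_smul_self (θ : (E₁ × E₂) [⋀^Fin 2]→L[ℝ] ℝ) (u : E₁) :
    (θ.compContinuousLinearMap (ContinuousLinearMap.inl ℝ E₁ E₂)) ![I • u, u] = θ ![I • ((u, 0) : E₁ × E₂), (u, 0)] := by
  rw [ContinuousAlternatingMap.compContinuousLinearMap_apply]
  congr 1
  funext i
  fin_cases i
  · simp [Prod.smul_mk]
  · rfl

omit [Fintype ι₁] [Fintype ι₂] in
/-- `H_{ι₂^*θ}(w) = H_θ(0, w)`. [folklore] -/
private theorem compInr_apply_I_smul_self (θ : (E₁ × E₂) [⋀^Fin 2]→L[ℝ] ℝ) (w : E₂) :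
    (θ.compContinuousLinearMap (ContinuousLinearMap.inr ℝ E₁ E₂)) ![I • w, w] = θ ![I • ((0, w) : E₁ × E₂), (0, w)] := by
  rw [ContinuousAlternatingMap.compContinuousLinearMap_apply]
  congr 1
  funext i
  fin_cases i
  · simp [Prod.smul_mk]
  · rfl

omit [Fintype ι₂] in
/-- `p₁^* NS(X₁) ⊆ NS(X₁ × X₂)`. [cite: Lange2023AbelianVarietiesComplex, §2.1.1 Cor. 2.1.4] -/
private theorem isNSForm_compFst [Fintype ι₂] {a : E₁ [⋀^Fin 2]→L[ℝ] ℝ} (ha : IsNSForm Φ₁ a) :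
    IsNSForm (prodPeriod Φ₁ Φ₂) (a.compContinuousLinearMap (ContinuousLinearMap.fst ℝ E₁ E₂)) := by
  refine ⟨fun u v ↦ ?_, fun m n ↦ ?_⟩
  · rw [ContinuousAlternatingMap.compContinuousLinearMap_apply, ContinuousAlternatingMap.compContinuousLinearMap_apply]
    have h : (⇑(ContinuousLinearMap.fst ℝ E₁ E₂) ∘ ![I • u, I • v]) = ![I • u.1, I • v.1] := by
      funext i
      fin_cases i <;> rfl
    have h' : (⇑(ContinuousLinearMap.fst ℝ E₁ E₂) ∘ ![u, v]) = ![u.1, v.1] := by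
      funext i
      fin_cases i <;> rfl
    rw [h, h', ha.type_one_one]
  · obtain ⟨k, hk⟩ := ha.integral (fun i ↦ m (Sum.inl i)) (fun i ↦ n (Sum.inl i))
    refine ⟨k, ?_⟩
    rw [ContinuousAlternatingMap.compContinuousLinearMap_apply, latticeVec_prodPeriod, latticeVec_prodPeriod]
    have h : (⇑(ContinuousLinearMap.fst ℝ E₁ E₂) ∘
        ![((latticeVec Φ₁ fun i ↦ m (Sum.inl i), latticeVec Φ₂ fun j ↦ m (Sum.inr j)) : E₁ × E₂),
          (latticeVec Φ₁ fun i ↦ n (Sum.inl i), latticeVec Φ₂ fun j ↦ n (Sum.inr j))]) =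
        ![latticeVec Φ₁ fun i ↦ m (Sum.inl i), latticeVec Φ₁ fun i ↦ n (Sum.inl i)] := by
      funext i
      fin_cases i <;> rfl
    rw [h, hk]

omit [Fintype ι₁] in
/-- `p₂^* NS(X₂) ⊆ NS(X₁ × X₂)`. [cite: Lange2023AbelianVarietiesComplex, §2.1.1 Cor. 2.1.4] -/
private theorem isNSForm_compSnd [Fintype ι₁] {b : E₂ [⋀^Fin 2]→L[ℝ] ℝ} (hb : IsNSForm Φ₂ b) :
    IsNSForm (prodPeriod Φ₁ Φ₂) (b.compContinuousLinearMap (ContinuousLinearMap.snd ℝ E₁ E₂)) := by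
  refine ⟨fun u v ↦ ?_, fun m n ↦ ?_⟩
  · rw [ContinuousAlternatingMap.compContinuousLinearMap_apply, ContinuousAlternatingMap.compContinuousLinearMap_apply]
    have h : (⇑(ContinuousLinearMap.snd ℝ E₁ E₂) ∘ ![I • u, I • v]) = ![I • u.2, I • v.2] := by
      funext i
      fin_cases i <;> rfl
    have h' : (⇑(ContinuousLinearMap.snd ℝ E₁ E₂) ∘ ![u, v]) = ![u.2, v.2] := by
      funext i
      fin_cases i <;> rfl
    rw [h, h', hb.type_one_one]
  · obtain ⟨k, hk⟩ := hb.integral (fun j ↦ m (Sum.inr j)) (fun j ↦ n (Sum.inr j))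
    refine ⟨k, ?_⟩
    rw [ContinuousAlternatingMap.compContinuousLinearMap_apply, latticeVec_prodPeriod, latticeVec_prodPeriod]
    have h : (⇑(ContinuousLinearMap.snd ℝ E₁ E₂) ∘
        ![((latticeVec Φ₁ fun i ↦ m (Sum.inl i), latticeVec Φ₂ fun j ↦ m (Sum.inr j)) : E₁ × E₂),
          (latticeVec Φ₁ fun i ↦ n (Sum.inl i), latticeVec Φ₂ fun j ↦ n (Sum.inr j))]) =
        ![latticeVec Φ₂ fun j ↦ m (Sum.inr j), latticeVec Φ₂ fun j ↦ n (Sum.inr j)] := by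
      funext i
      fin_cases i <;> rfl
    rw [h, hk]

variable [DecidableEq ι₁] [DecidableEq ι₂]

omit [DecidableEq ι₁] [DecidableEq ι₂] in
/-- **`p₁^* N(X₁) ⊆ N(X₁ × X₂)`**: the pull-back of a semi-positive class of `NS(X₁)` along the projection is
a semi-positive class of `NS(X₁ × X₂)`. [cite: Bauer1998ConeOfCurves, §4 Thm. 4.2 (proof: "`pr_i^* Nᵢ`")] -/
theorem isNSForm_and_semipos_compFst {a : E₁ [⋀^Fin 2]→L[ℝ] ℝ} (ha : IsNSForm Φ₁ a ∧ ∀ u : E₁, 0 ≤ a ![I • u, u]) :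
    IsNSForm (prodPeriod Φ₁ Φ₂) (a.compContinuousLinearMap (ContinuousLinearMap.fst ℝ E₁ E₂)) ∧
      ∀ v : E₁ × E₂, 0 ≤ (a.compContinuousLinearMap (ContinuousLinearMap.fst ℝ E₁ E₂)) ![I • v, v] :=
  ⟨isNSForm_compFst Φ₁ Φ₂ ha.1, fun v ↦ by rw [compFst_apply_I_smul_self]; exact ha.2 _⟩

omit [DecidableEq ι₁] [DecidableEq ι₂] in
/-- **`p₂^* N(X₂) ⊆ N(X₁ × X₂)`.** [cite: Bauer1998ConeOfCurves, §4 Thm. 4.2 (proof: "`pr_i^* Nᵢ`")] -/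
theorem isNSForm_and_semipos_compSnd {b : E₂ [⋀^Fin 2]→L[ℝ] ℝ} (hb : IsNSForm Φ₂ b ∧ ∀ w : E₂, 0 ≤ b ![I • w, w]) :
    IsNSForm (prodPeriod Φ₁ Φ₂) (b.compContinuousLinearMap (ContinuousLinearMap.snd ℝ E₁ E₂)) ∧
      ∀ v : E₁ × E₂, 0 ≤ (b.compContinuousLinearMap (ContinuousLinearMap.snd ℝ E₁ E₂)) ![I • v, v] :=
  ⟨isNSForm_compSnd Φ₁ Φ₂ hb.1, fun v ↦ by rw [compSnd_apply_I_smul_self]; exact hb.2 _⟩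

omit [DecidableEq ι₂] in
/-- **`ι₁^* N(X₁ × X₂) ⊆ N(X₁)`**: restriction of a semi-positive class of the product to the factor
`X₁ × {0}` is a semi-positive class of `NS(X₁)`. [cite: Milne1999LefschetzClasses, §4 Prop. 4.1 (proof)] -/
theorem isNSForm_and_semipos_compInl {θ : (E₁ × E₂) [⋀^Fin 2]→L[ℝ] ℝ}
    (hθ : IsNSForm (prodPeriod Φ₁ Φ₂) θ ∧ ∀ v : E₁ × E₂, 0 ≤ θ ![I • v, v]) :
    IsNSForm Φ₁ (θ.compContinuousLinearMap (ContinuousLinearMap.inl ℝ E₁ E₂)) ∧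
      ∀ u : E₁, 0 ≤ (θ.compContinuousLinearMap (ContinuousLinearMap.inl ℝ E₁ E₂)) ![I • u, u] :=
  ⟨hθ.1.comp_inl Φ₁ Φ₂, fun u ↦ by rw [compInl_apply_I_smul_self]; exact hθ.2 _⟩

omit [DecidableEq ι₁] in
/-- **`ι₂^* N(X₁ × X₂) ⊆ N(X₂)`.** [cite: Milne1999LefschetzClasses, §4 Prop. 4.1 (proof)] -/
theorem isNSForm_and_semipos_compInr {θ : (E₁ × E₂) [⋀^Fin 2]→L[ℝ] ℝ}
    (hθ : IsNSForm (prodPeriod Φ₁ Φ₂) θ ∧ ∀ v : E₁ × E₂, 0 ≤ θ ![I • v, v]) :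
    IsNSForm Φ₂ (θ.compContinuousLinearMap (ContinuousLinearMap.inr ℝ E₁ E₂)) ∧
      ∀ w : E₂, 0 ≤ (θ.compContinuousLinearMap (ContinuousLinearMap.inr ℝ E₁ E₂)) ![I • w, w] :=
  ⟨hθ.1.comp_inr Φ₁ Φ₂, fun w ↦ by rw [compInr_apply_I_smul_self]; exact hθ.2 _⟩

end Restrict

/-! ### §2 "If `N(V₁ × V₂)` is finitely generated, then `N(V₁)` and `N(V₂)` are finitely generated" -/

section Descend

variable {ι₁ ι₂ : Type*} [Fintype ι₁] [Fintype ι₂] [DecidableEq ι₁] [DecidableEq ι₂] {E₁ E₂ : Type*}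
  [NormedAddCommGroup E₁] [NormedSpace ℂ E₁] [NormedAddCommGroup E₂] [NormedSpace ℂ E₂]
  (Φ₁ : (ι₁ → ℝ) ≃L[ℝ] E₁) (Φ₂ : (ι₂ → ℝ) ≃L[ℝ] E₂)

omit [DecidableEq ι₂] in
/-- **"Note that if `V₁` and `V₂` are varieties such that `N(V₁ × V₂)` is finitely generated, then `N(V₁)`
[is] finitely generated as well"**: the restriction `ι₁^* : N(X₁ × X₂) → N(X₁)` is an additive map onto
`N(X₁)` (`ι₁^* p₁^* = id`), so the restrictions of generators generate. For all complex tori `X₁`, `X₂`.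
[cite: Bauer1998ConeOfCurves, §4 Thm. 4.2 (proof)] -/
theorem exists_finset_addSubmonoidClosure_eq_left_of_prod {S : Finset ((E₁ × E₂) [⋀^Fin 2]→L[ℝ] ℝ)}
    (hS : (AddSubmonoid.closure (S : Set ((E₁ × E₂) [⋀^Fin 2]→L[ℝ] ℝ)) : Set ((E₁ × E₂) [⋀^Fin 2]→L[ℝ] ℝ)) =
      {θ | IsNSForm (prodPeriod Φ₁ Φ₂) θ ∧ ∀ v : E₁ × E₂, 0 ≤ θ ![I • v, v]}) :
    ∃ S₁ : Finset (E₁ [⋀^Fin 2]→L[ℝ] ℝ),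
      (AddSubmonoid.closure (S₁ : Set (E₁ [⋀^Fin 2]→L[ℝ] ℝ)) : Set (E₁ [⋀^Fin 2]→L[ℝ] ℝ)) =
        {a | IsNSForm Φ₁ a ∧ ∀ u : E₁, 0 ≤ a ![I • u, u]} := by
  classical
  set r : ((E₁ × E₂) [⋀^Fin 2]→L[ℝ] ℝ) →ₗ[ℝ] (E₁ [⋀^Fin 2]→L[ℝ] ℝ) :=
    ContinuousAlternatingMap.compContinuousLinearMapₗ (ContinuousLinearMap.inl ℝ E₁ E₂) with hr
  have hr_apply : ∀ θ, r θ = θ.compContinuousLinearMap (ContinuousLinearMap.inl ℝ E₁ E₂) := fun θ ↦ rfl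
  refine ⟨S.image r, Set.Subset.antisymm ?_ ?_⟩
  · -- the restricted generators lie in the submonoid `N(X₁)`
    have hle : AddSubmonoid.closure ((S.image r : Finset _) : Set (E₁ [⋀^Fin 2]→L[ℝ] ℝ)) ≤
        ((neronSeveriGroup Φ₁).toAddSubmonoid ⊓
          { carrier := {a | ∀ u : E₁, 0 ≤ a ![I • u, u]}
            add_mem' := fun {a b} ha hb u ↦ by
              rw [ContinuousAlternatingMap.add_apply]
              exact add_nonneg (ha u) (hb u)
            zero_mem' := fun u ↦ by rw [ContinuousAlternatingMap.coe_zero, Pi.zero_apply] }) := by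
      refine AddSubmonoid.closure_le.2 fun a ha ↦ ?_
      rw [Finset.coe_image] at ha
      obtain ⟨θ, hθ, rfl⟩ := ha
      have hθ' : θ ∈ (AddSubmonoid.closure (S : Set ((E₁ × E₂) [⋀^Fin 2]→L[ℝ] ℝ)) :
          Set ((E₁ × E₂) [⋀^Fin 2]→L[ℝ] ℝ)) := AddSubmonoid.subset_closure hθ
      rw [hS] at hθ'
      exact isNSForm_and_semipos_compInl Φ₁ Φ₂ hθ'
    intro a ha
    have h' := hle ha
    exact ⟨h'.1, h'.2⟩
  · rintro a ⟨ha, hpsd⟩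
    -- `p₁^* a ∈ N(X₁ × X₂) = closure S`, and `a = ι₁^* p₁^* a`
    have hmem : a.compContinuousLinearMap (ContinuousLinearMap.fst ℝ E₁ E₂) ∈
        AddSubmonoid.closure (S : Set ((E₁ × E₂) [⋀^Fin 2]→L[ℝ] ℝ)) := by
      have h : a.compContinuousLinearMap (ContinuousLinearMap.fst ℝ E₁ E₂) ∈
          (AddSubmonoid.closure (S : Set ((E₁ × E₂) [⋀^Fin 2]→L[ℝ] ℝ)) : Set ((E₁ × E₂) [⋀^Fin 2]→L[ℝ] ℝ)) := by
        rw [hS]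
        exact isNSForm_and_semipos_compFst Φ₁ Φ₂ ⟨ha, hpsd⟩
      exact h
    have himage := AddSubmonoid.mem_map_of_mem r.toAddMonoidHom hmem
    rw [AddMonoidHom.map_mclosure] at himage
    have heq : r.toAddMonoidHom (a.compContinuousLinearMap (ContinuousLinearMap.fst ℝ E₁ E₂)) = a := by
      change r _ = a
      rw [hr_apply, compFst_compInl]
    rw [heq] at himage
    have hcoe : (⇑r.toAddMonoidHom '' (S : Set ((E₁ × E₂) [⋀^Fin 2]→L[ℝ] ℝ))) =
        ((S.image r : Finset _) : Set (E₁ [⋀^Fin 2]→L[ℝ] ℝ)) := by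
      rw [Finset.coe_image]
      rfl
    rw [hcoe] at himage
    exact himage

omit [DecidableEq ι₁] in
/-- **… and `N(V₂)` is finitely generated as well** (restriction to `{0} × X₂`).
[cite: Bauer1998ConeOfCurves, §4 Thm. 4.2 (proof)] -/
theorem exists_finset_addSubmonoidClosure_eq_right_of_prod {S : Finset ((E₁ × E₂) [⋀^Fin 2]→L[ℝ] ℝ)}
    (hS : (AddSubmonoid.closure (S : Set ((E₁ × E₂) [⋀^Fin 2]→L[ℝ] ℝ)) : Set ((E₁ × E₂) [⋀^Fin 2]→L[ℝ] ℝ)) =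
      {θ | IsNSForm (prodPeriod Φ₁ Φ₂) θ ∧ ∀ v : E₁ × E₂, 0 ≤ θ ![I • v, v]}) :
    ∃ S₂ : Finset (E₂ [⋀^Fin 2]→L[ℝ] ℝ),
      (AddSubmonoid.closure (S₂ : Set (E₂ [⋀^Fin 2]→L[ℝ] ℝ)) : Set (E₂ [⋀^Fin 2]→L[ℝ] ℝ)) =
        {b | IsNSForm Φ₂ b ∧ ∀ w : E₂, 0 ≤ b ![I • w, w]} := by
  classical
  set r : ((E₁ × E₂) [⋀^Fin 2]→L[ℝ] ℝ) →ₗ[ℝ] (E₂ [⋀^Fin 2]→L[ℝ] ℝ) :=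
    ContinuousAlternatingMap.compContinuousLinearMapₗ (ContinuousLinearMap.inr ℝ E₁ E₂) with hr
  have hr_apply : ∀ θ, r θ = θ.compContinuousLinearMap (ContinuousLinearMap.inr ℝ E₁ E₂) := fun θ ↦ rfl
  refine ⟨S.image r, Set.Subset.antisymm ?_ ?_⟩
  · have hle : AddSubmonoid.closure ((S.image r : Finset _) : Set (E₂ [⋀^Fin 2]→L[ℝ] ℝ)) ≤
        ((neronSeveriGroup Φ₂).toAddSubmonoid ⊓
          { carrier := {b | ∀ w : E₂, 0 ≤ b ![I • w, w]}
            add_mem' := fun {a b} ha hb w ↦ by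
              rw [ContinuousAlternatingMap.add_apply]
              exact add_nonneg (ha w) (hb w)
            zero_mem' := fun w ↦ by rw [ContinuousAlternatingMap.coe_zero, Pi.zero_apply] }) := by
      refine AddSubmonoid.closure_le.2 fun b hb ↦ ?_
      rw [Finset.coe_image] at hb
      obtain ⟨θ, hθ, rfl⟩ := hb
      have hθ' : θ ∈ (AddSubmonoid.closure (S : Set ((E₁ × E₂) [⋀^Fin 2]→L[ℝ] ℝ)) :
          Set ((E₁ × E₂) [⋀^Fin 2]→L[ℝ] ℝ)) := AddSubmonoid.subset_closure hθ
      rw [hS] at hθ'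
      exact isNSForm_and_semipos_compInr Φ₁ Φ₂ hθ'
    intro b hb
    have h' := hle hb
    exact ⟨h'.1, h'.2⟩
  · rintro b ⟨hb, hpsd⟩
    have hmem : b.compContinuousLinearMap (ContinuousLinearMap.snd ℝ E₁ E₂) ∈
        AddSubmonoid.closure (S : Set ((E₁ × E₂) [⋀^Fin 2]→L[ℝ] ℝ)) := by
      have h : b.compContinuousLinearMap (ContinuousLinearMap.snd ℝ E₁ E₂) ∈
          (AddSubmonoid.closure (S : Set ((E₁ × E₂) [⋀^Fin 2]→L[ℝ] ℝ)) : Set ((E₁ × E₂) [⋀^Fin 2]→L[ℝ] ℝ)) := by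
        rw [hS]
        exact isNSForm_and_semipos_compSnd Φ₁ Φ₂ ⟨hb, hpsd⟩
      exact h
    have himage := AddSubmonoid.mem_map_of_mem r.toAddMonoidHom hmem
    rw [AddMonoidHom.map_mclosure] at himage
    have heq : r.toAddMonoidHom (b.compContinuousLinearMap (ContinuousLinearMap.snd ℝ E₁ E₂)) = b := by
      change r _ = b
      rw [hr_apply, compSnd_compInr]
    rw [heq] at himage
    have hcoe : (⇑r.toAddMonoidHom '' (S : Set ((E₁ × E₂) [⋀^Fin 2]→L[ℝ] ℝ))) =
        ((S.image r : Finset _) : Set (E₂ [⋀^Fin 2]→L[ℝ] ℝ)) := by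
      rw [Finset.coe_image]
      rfl
    rw [hcoe] at himage
    exact himage

end Descend

/-! ### §3 `N(X₁ × X₂) = p₁^* N(X₁) + p₂^* N(X₂)` when the divisorial correspondences vanish -/

section Ascend

variable {ι₁ ι₂ : Type*} [Fintype ι₁] [Fintype ι₂] [DecidableEq ι₁] [DecidableEq ι₂] {E₁ E₂ : Type*}
  [NormedAddCommGroup E₁] [NormedSpace ℂ E₁] [NormedAddCommGroup E₂] [NormedSpace ℂ E₂]
  (Φ₁ : (ι₁ → ℝ) ≃L[ℝ] E₁) (Φ₂ : (ι₂ → ℝ) ≃L[ℝ] E₂)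

/-- **"`NS_ℚ(∏ Xᵢ) ≅ ⊕ NS_ℚ(Xᵢ)`, therefore `N(X) = ⊕ N(Xᵢ)`" for two factors**: if every class of
`NS(X₁ × X₂)` has vanishing mixed Künneth component (`DC(X₁, X₂) ⊗ ℚ = 0`, e.g. `Hom_ℚ(X₂, X₁) = 0`), then the
semi-positive classes of `NS(X₁ × X₂)` are exactly the sums `p₁^*a + p₂^*b` of semi-positive classes `a` of
`NS(X₁)` and `b` of `NS(X₂)` (namely `a = ι₁^*θ`, `b = ι₂^*θ`). [cite: Bauer1998ConeOfCurves, §4 Thm. 4.2 (proof, "if")]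
[cite: Milne1999LefschetzClasses, §4 Prop. 4.1 (proof)] -/
theorem setOf_semipos_prod_eq_of_forall_apply_inl_inr_eq_zero
    (hDC : ∀ η : (E₁ × E₂) [⋀^Fin 2]→L[ℝ] ℝ, IsNSForm (prodPeriod Φ₁ Φ₂) η →
      ∀ (u : E₁) (w : E₂), η ![(u, 0), (0, w)] = 0) :
    {θ : (E₁ × E₂) [⋀^Fin 2]→L[ℝ] ℝ | IsNSForm (prodPeriod Φ₁ Φ₂) θ ∧ ∀ v : E₁ × E₂, 0 ≤ θ ![I • v, v]} =
      {θ | ∃ a b, (IsNSForm Φ₁ a ∧ ∀ u : E₁, 0 ≤ a ![I • u, u]) ∧ (IsNSForm Φ₂ b ∧ ∀ w : E₂, 0 ≤ b ![I • w, w]) ∧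
        θ = a.compContinuousLinearMap (ContinuousLinearMap.fst ℝ E₁ E₂) +
          b.compContinuousLinearMap (ContinuousLinearMap.snd ℝ E₁ E₂)} := by
  refine Set.ext fun θ ↦ ⟨fun hθ ↦ ?_, ?_⟩
  · exact ⟨_, _, isNSForm_and_semipos_compInl Φ₁ Φ₂ hθ, isNSForm_and_semipos_compInr Φ₁ Φ₂ hθ,
      twoForm_eq_compFst_add_compSnd_of_apply_inl_inr_eq_zero θ (hDC θ hθ.1)⟩
  · rintro ⟨a, b, ha, hb, rfl⟩
    have ha' := isNSForm_and_semipos_compFst Φ₁ Φ₂ ha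
    have hb' := isNSForm_and_semipos_compSnd Φ₁ Φ₂ hb
    refine ⟨ha'.1.add hb'.1, fun v ↦ ?_⟩
    rw [ContinuousAlternatingMap.add_apply]
    exact add_nonneg (ha'.2 v) (hb'.2 v)

/-- **Finite generation ascends to the product when `DC(X₁, X₂) ⊗ ℚ = 0`**: if `N(X₁)` and `N(X₂)` are
generated by finite sets `S₁`, `S₂`, then `N(X₁ × X₂)` is generated by `p₁^*S₁ ∪ p₂^*S₂` ("Therefore
`N(X) = ⊕ᵢ ℤ⁺·[Nᵢ]` is finitely generated"). [cite: Bauer1998ConeOfCurves, §4 Thm. 4.2 (proof, "if")] -/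
theorem exists_finset_addSubmonoidClosure_eq_prod_of_forall_apply_inl_inr_eq_zero
    (hDC : ∀ η : (E₁ × E₂) [⋀^Fin 2]→L[ℝ] ℝ, IsNSForm (prodPeriod Φ₁ Φ₂) η →
      ∀ (u : E₁) (w : E₂), η ![(u, 0), (0, w)] = 0)
    {S₁ : Finset (E₁ [⋀^Fin 2]→L[ℝ] ℝ)} {S₂ : Finset (E₂ [⋀^Fin 2]→L[ℝ] ℝ)}
    (hS₁ : (AddSubmonoid.closure (S₁ : Set (E₁ [⋀^Fin 2]→L[ℝ] ℝ)) : Set (E₁ [⋀^Fin 2]→L[ℝ] ℝ)) =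
      {a | IsNSForm Φ₁ a ∧ ∀ u : E₁, 0 ≤ a ![I • u, u]})
    (hS₂ : (AddSubmonoid.closure (S₂ : Set (E₂ [⋀^Fin 2]→L[ℝ] ℝ)) : Set (E₂ [⋀^Fin 2]→L[ℝ] ℝ)) =
      {b | IsNSForm Φ₂ b ∧ ∀ w : E₂, 0 ≤ b ![I • w, w]}) :
    ∃ S : Finset ((E₁ × E₂) [⋀^Fin 2]→L[ℝ] ℝ),
      (AddSubmonoid.closure (S : Set ((E₁ × E₂) [⋀^Fin 2]→L[ℝ] ℝ)) : Set ((E₁ × E₂) [⋀^Fin 2]→L[ℝ] ℝ)) =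
        {θ | IsNSForm (prodPeriod Φ₁ Φ₂) θ ∧ ∀ v : E₁ × E₂, 0 ≤ θ ![I • v, v]} := by
  classical
  set p₁ : (E₁ [⋀^Fin 2]→L[ℝ] ℝ) →ₗ[ℝ] ((E₁ × E₂) [⋀^Fin 2]→L[ℝ] ℝ) :=
    ContinuousAlternatingMap.compContinuousLinearMapₗ (ContinuousLinearMap.fst ℝ E₁ E₂) with hp₁
  set p₂ : (E₂ [⋀^Fin 2]→L[ℝ] ℝ) →ₗ[ℝ] ((E₁ × E₂) [⋀^Fin 2]→L[ℝ] ℝ) :=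
    ContinuousAlternatingMap.compContinuousLinearMapₗ (ContinuousLinearMap.snd ℝ E₁ E₂) with hp₂
  have hp₁_apply : ∀ a, p₁ a = a.compContinuousLinearMap (ContinuousLinearMap.fst ℝ E₁ E₂) := fun a ↦ rfl
  have hp₂_apply : ∀ b, p₂ b = b.compContinuousLinearMap (ContinuousLinearMap.snd ℝ E₁ E₂) := fun b ↦ rfl
  refine ⟨S₁.image p₁ ∪ S₂.image p₂, Set.Subset.antisymm ?_ ?_⟩
  · -- the generators lie in the submonoid `N(X₁ × X₂)`
    have hle : AddSubmonoid.closure ((S₁.image p₁ ∪ S₂.image p₂ : Finset _) : Set ((E₁ × E₂) [⋀^Fin 2]→L[ℝ] ℝ)) ≤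
        ((neronSeveriGroup (prodPeriod Φ₁ Φ₂)).toAddSubmonoid ⊓
          { carrier := {θ | ∀ v : E₁ × E₂, 0 ≤ θ ![I • v, v]}
            add_mem' := fun {a b} ha hb v ↦ by
              rw [ContinuousAlternatingMap.add_apply]
              exact add_nonneg (ha v) (hb v)
            zero_mem' := fun v ↦ by rw [ContinuousAlternatingMap.coe_zero, Pi.zero_apply] }) := by
      refine AddSubmonoid.closure_le.2 fun θ hθ ↦ ?_
      rw [Finset.coe_union, Finset.coe_image, Finset.coe_image] at hθ
      rcases hθ with ⟨a, ha, rfl⟩ | ⟨b, hb, rfl⟩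
      · have ha' : a ∈ (AddSubmonoid.closure (S₁ : Set (E₁ [⋀^Fin 2]→L[ℝ] ℝ)) : Set (E₁ [⋀^Fin 2]→L[ℝ] ℝ)) :=
          AddSubmonoid.subset_closure ha
        rw [hS₁] at ha'
        exact isNSForm_and_semipos_compFst Φ₁ Φ₂ ha'
      · have hb' : b ∈ (AddSubmonoid.closure (S₂ : Set (E₂ [⋀^Fin 2]→L[ℝ] ℝ)) : Set (E₂ [⋀^Fin 2]→L[ℝ] ℝ)) :=
          AddSubmonoid.subset_closure hb
        rw [hS₂] at hb'
        exact isNSForm_and_semipos_compSnd Φ₁ Φ₂ hb'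
    intro θ hθ
    have h' := hle hθ
    exact ⟨h'.1, h'.2⟩
  · intro θ hθ
    rw [setOf_semipos_prod_eq_of_forall_apply_inl_inr_eq_zero Φ₁ Φ₂ hDC] at hθ
    obtain ⟨a, b, ha, hb, rfl⟩ := hθ
    have ha' : a ∈ AddSubmonoid.closure (S₁ : Set (E₁ [⋀^Fin 2]→L[ℝ] ℝ)) := by
      have h : a ∈ (AddSubmonoid.closure (S₁ : Set (E₁ [⋀^Fin 2]→L[ℝ] ℝ)) : Set (E₁ [⋀^Fin 2]→L[ℝ] ℝ)) := by
        rw [hS₁]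
        exact ha
      exact h
    have hb' : b ∈ AddSubmonoid.closure (S₂ : Set (E₂ [⋀^Fin 2]→L[ℝ] ℝ)) := by
      have h : b ∈ (AddSubmonoid.closure (S₂ : Set (E₂ [⋀^Fin 2]→L[ℝ] ℝ)) : Set (E₂ [⋀^Fin 2]→L[ℝ] ℝ)) := by
        rw [hS₂]
        exact hb
      exact h
    have h₁ := AddSubmonoid.mem_map_of_mem p₁.toAddMonoidHom ha'
    have h₂ := AddSubmonoid.mem_map_of_mem p₂.toAddMonoidHom hb'
    rw [AddMonoidHom.map_mclosure] at h₁ h₂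
    have hsub₁ : (⇑p₁.toAddMonoidHom '' (S₁ : Set (E₁ [⋀^Fin 2]→L[ℝ] ℝ))) ⊆
        ((S₁.image p₁ ∪ S₂.image p₂ : Finset _) : Set ((E₁ × E₂) [⋀^Fin 2]→L[ℝ] ℝ)) := by
      rw [Finset.coe_union, Finset.coe_image]
      exact Set.subset_union_left
    have hsub₂ : (⇑p₂.toAddMonoidHom '' (S₂ : Set (E₂ [⋀^Fin 2]→L[ℝ] ℝ))) ⊆
        ((S₁.image p₁ ∪ S₂.image p₂ : Finset _) : Set ((E₁ × E₂) [⋀^Fin 2]→L[ℝ] ℝ)) := by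
      rw [Finset.coe_union, Finset.coe_image, Finset.coe_image]
      exact Set.subset_union_right
    exact AddSubmonoid.add_mem _ (AddSubmonoid.closure_mono hsub₁ h₁) (AddSubmonoid.closure_mono hsub₂ h₂)

/-- **For abelian varieties `X₁`, `X₂` with `Hom_ℚ(X₂, X₁) = 0`, finite generation of `N(X₁)` and `N(X₂)`
gives finite generation of `N(X₁ × X₂)`** (`DC(X₁, X₂) ⊗ ℚ = 0` by Milne's Cor. 4.2,
`IsAbelianVariety.forall_apply_inl_inr_eq_zero_of_homRat_eq_bot`). [cite: Bauer1998ConeOfCurves, §4 Thm. 4.2 (proof, "if")]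
[cite: Milne1999LefschetzClasses, §4 Cor. 4.2] -/
theorem IsAbelianVariety.exists_finset_addSubmonoidClosure_eq_prod_of_homRat_eq_bot (hX₁ : IsAbelianVariety Φ₁)
    (hHom : homRat Φ₂ Φ₁ = ⊥) {S₁ : Finset (E₁ [⋀^Fin 2]→L[ℝ] ℝ)} {S₂ : Finset (E₂ [⋀^Fin 2]→L[ℝ] ℝ)}
    (hS₁ : (AddSubmonoid.closure (S₁ : Set (E₁ [⋀^Fin 2]→L[ℝ] ℝ)) : Set (E₁ [⋀^Fin 2]→L[ℝ] ℝ)) =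
      {a | IsNSForm Φ₁ a ∧ ∀ u : E₁, 0 ≤ a ![I • u, u]})
    (hS₂ : (AddSubmonoid.closure (S₂ : Set (E₂ [⋀^Fin 2]→L[ℝ] ℝ)) : Set (E₂ [⋀^Fin 2]→L[ℝ] ℝ)) =
      {b | IsNSForm Φ₂ b ∧ ∀ w : E₂, 0 ≤ b ![I • w, w]}) :
    ∃ S : Finset ((E₁ × E₂) [⋀^Fin 2]→L[ℝ] ℝ),
      (AddSubmonoid.closure (S : Set ((E₁ × E₂) [⋀^Fin 2]→L[ℝ] ℝ)) : Set ((E₁ × E₂) [⋀^Fin 2]→L[ℝ] ℝ)) =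
        {θ | IsNSForm (prodPeriod Φ₁ Φ₂) θ ∧ ∀ v : E₁ × E₂, 0 ≤ θ ![I • v, v]} :=
  exists_finset_addSubmonoidClosure_eq_prod_of_forall_apply_inl_inr_eq_zero Φ₁ Φ₂
    (hX₁.forall_apply_inl_inr_eq_zero_of_homRat_eq_bot Φ₂ hHom) hS₁ hS₂

end Ascend

/-! ### §4 Thm. 4.2 for two simple factors, and its transport along isogenies -/

section ThmFourTwo

variable {ι₁ ι₂ : Type*} [Fintype ι₁] [Fintype ι₂] [DecidableEq ι₁] [DecidableEq ι₂] {E₁ E₂ : Type*}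
  [NormedAddCommGroup E₁] [NormedSpace ℂ E₁] [NormedAddCommGroup E₂] [NormedSpace ℂ E₂]
  (Φ₁ : (ι₁ → ℝ) ≃L[ℝ] E₁) (Φ₂ : (ι₂ → ℝ) ≃L[ℝ] E₂)

/-- **Bauer 1998, Thm. 4.2 for two simple factors.** For SIMPLE complex abelian varieties `X₁, X₂ ≠ 0`, the
semigroup `N(X₁ × X₂)` of effective (= semi-positive) classes of `X₁ × X₂` is finitely generated if and only
if `X₁` and `X₂` are NOT isogenous and `NS(X₁) ≅ ℤ ≅ NS(X₂)` (`rk = 1`). "Only if": finite generation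
descends to the factors (§2), which are simple, so `rk NS(Xᵢ) = 1` by Prop. 2.2 (file 50); and were
`X₁ ~ X₂`, then `X₁ × X₂ ~ X₂ × X₂` would have finitely generated `N`, against Prop. 3.1 (file 52, through
Lemma 4.1). "If": `N(Xᵢ) = ℤ⁺·[Mᵢ]` (file 50) and `N(X₁ × X₂) = p₁^*N(X₁) + p₂^*N(X₂)` as
`Hom(X₂, X₁) = 0` for non-isogenous simple varieties (§3). [cite: Bauer1998ConeOfCurves, §4 Thm. 4.2] -/
theorem IsSimple.exists_finset_addSubmonoidClosure_eq_prod_iff [Nontrivial E₁] [Nontrivial E₂]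
    (hS₁ : IsSimple Φ₁) (hS₂ : IsSimple Φ₂) (hX₁ : IsAbelianVariety Φ₁) (hX₂ : IsAbelianVariety Φ₂) :
    (∃ S : Finset ((E₁ × E₂) [⋀^Fin 2]→L[ℝ] ℝ),
        (AddSubmonoid.closure (S : Set ((E₁ × E₂) [⋀^Fin 2]→L[ℝ] ℝ)) : Set ((E₁ × E₂) [⋀^Fin 2]→L[ℝ] ℝ)) =
          {θ | IsNSForm (prodPeriod Φ₁ Φ₂) θ ∧ ∀ v : E₁ × E₂, 0 ≤ θ ![I • v, v]}) ↔
      ¬ IsIsogenous Φ₁ Φ₂ ∧ finrank ℤ (neronSeveriGroup Φ₁) = 1 ∧ finrank ℤ (neronSeveriGroup Φ₂) = 1 := by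
  constructor
  · rintro ⟨S, hS⟩
    refine ⟨fun hiso ↦ ?_, ?_, ?_⟩
    · -- `X₁ × X₂ ~ X₂ × X₂`, impossible
      have hprod : IsIsogenous (prodPeriod Φ₁ Φ₂) (prodPeriod Φ₂ Φ₂) := hiso.prod (IsIsogenous.refl Φ₂)
      exact hprod.not_exists_finset_addSubmonoidClosure_eq_of_prod Φ₂ hX₂ ⟨S, hS⟩
    · obtain ⟨S₁, hS₁'⟩ := exists_finset_addSubmonoidClosure_eq_left_of_prod Φ₁ Φ₂ hS
      exact hS₁.finrank_neronSeveriGroup_eq_one_of_addSubmonoidClosure_eq Φ₁ hX₁ hS₁'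
    · obtain ⟨S₂, hS₂'⟩ := exists_finset_addSubmonoidClosure_eq_right_of_prod Φ₁ Φ₂ hS
      exact hS₂.finrank_neronSeveriGroup_eq_one_of_addSubmonoidClosure_eq Φ₂ hX₂ hS₂'
  · rintro ⟨hni, h₁, h₂⟩
    obtain ⟨M₁, -, hM₁⟩ := exists_addSubmonoidClosure_singleton_eq_of_finrank_eq_one Φ₁ hX₁ h₁
    obtain ⟨M₂, -, hM₂⟩ := exists_addSubmonoidClosure_singleton_eq_of_finrank_eq_one Φ₂ hX₂ h₂
    have hHom : homRat Φ₂ Φ₁ = ⊥ := hS₂.homRat_eq_bot hS₁ fun h ↦ hni h.symm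
    refine hX₁.exists_finset_addSubmonoidClosure_eq_prod_of_homRat_eq_bot Φ₁ Φ₂ hHom (S₁ := {M₁}) (S₂ := {M₂})
      ?_ ?_
    · rw [Finset.coe_singleton]
      exact hM₁
    · rw [Finset.coe_singleton]
      exact hM₂

/-- **THE THEOREM, (ic) ⟺ (ii), for every complex torus `X` isogenous to a product `X₁ × X₂` of two simple
abelian varieties `≠ 0`**: `N(X)` is finitely generated iff `X₁ ≁ X₂` and `NS(X₁) ≅ NS(X₂) ≅ ℤ` — by
Lemma 4.1 (file 51) and Thm. 4.2 for the product. (With files 50 and 52: the Theorem for all abelian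
varieties with at most two simple factors counted with multiplicity.)
[cite: Bauer1998ConeOfCurves, §1 Theorem ((ic) ⟺ (ii)) and §4 Thm. 4.2, Lemma 4.1] -/
theorem IsIsogenous.exists_finset_addSubmonoidClosure_eq_iff_of_prod [Nontrivial E₁] [Nontrivial E₂]
    {ι : Type*} [Fintype ι] [DecidableEq ι] {E : Type*} [NormedAddCommGroup E] [NormedSpace ℂ E]
    {Φ : (ι → ℝ) ≃L[ℝ] E} (h : IsIsogenous Φ (prodPeriod Φ₁ Φ₂)) (hS₁ : IsSimple Φ₁) (hS₂ : IsSimple Φ₂)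
    (hX₁ : IsAbelianVariety Φ₁) (hX₂ : IsAbelianVariety Φ₂) :
    (∃ S : Finset (E [⋀^Fin 2]→L[ℝ] ℝ),
        (AddSubmonoid.closure (S : Set (E [⋀^Fin 2]→L[ℝ] ℝ)) : Set (E [⋀^Fin 2]→L[ℝ] ℝ)) =
          {η | IsNSForm Φ η ∧ ∀ v : E, 0 ≤ η ![I • v, v]}) ↔
      ¬ IsIsogenous Φ₁ Φ₂ ∧ finrank ℤ (neronSeveriGroup Φ₁) = 1 ∧ finrank ℤ (neronSeveriGroup Φ₂) = 1 := by
  rw [h.exists_finset_addSubmonoidClosure_eq_iff Φ (prodPeriod Φ₁ Φ₂)]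
  exact hS₁.exists_finset_addSubmonoidClosure_eq_prod_iff Φ₁ Φ₂ hS₂ hX₁ hX₂

end ThmFourTwo

end ComplexTorus

end Literature.Geometry.Kaehler

end
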